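import Literature.MathematicalPhysics.QuantumFieldTheory.Balaban1983to89.B11Eq7Convention

/-!
# `Balaban1983to89.B11Eq13Concrete` — T. Bałaban, *The variational problem and background fields in renormalization
# group method for lattice gauge theories*, Commun. Math. Phys. **102** (1985) 277–309 [Balaban1985Variational], Sect. A
# p. 280: the inference (12) ⇒ (13) *"From the conditions (11), and from the form (2) of the regularity conditions, it
# follows that U₀ ∈ 𝔘_k({Ω_j}, B₃L³ε₁) ∩ 𝔅_k(𝔅_k, V)"* and the sentence *"The configuration U₀ constructed above
# satisfies (14) with C₁ = L³"*, PROVED over the concrete multi-level carriers of `B11Eq7Convention` ((2) =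
# `B8Ineq132.InAk`, (3) = `InB`, `Λ_j` = `Lam`, admissibility (1) = `B8ConstraintBonds.DomainSeq`)

statement-level skeleton of published theorems with citation tags; proofs where landed; nothing here is a claim
about the Yang–Mills mass gap

PDF held: `paper:balaban1985-cmp102-variational-background` (journal page = PDF page + 276); pp. 279–280 (PDF 3–4) read
from the held text AND the x2 renders `…/1985-cmp102-variational-background-p003-x2.png`, `-p004-x2.png` (as images).
[4] = *Averaging operations …*, CMP **98** (1985) [Balaban1985Averaging] (B7): the averages (42)/(43)
(`B7Prop2Explicit.avgIter`) and their locality p. 24 (`B7Prop1Local.bavg_congr`); [6] = CMP **99** (1985)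
[Balaban1985RegularSpaces] (B8), Sect. A: the space (2) = `B8Ineq132.InAk` with its printed level arithmetic
`B8Ineq132.thr7_le_cube` / `thr9_le_cube` (the same `L³` as in (1.132) of [6]).

WHAT IS REPRODUCED.  SKELETON rows `B11.Eq12` ((12)–(13); decl of record the abstract leaf `B11Thm1.StepA13`, "typed-
existing (+kernel pieces proved)": the scale arithmetic `B11Thm1.ineq13_plaquette_factor/ineq13_bond_factor`) and
`B11.Eq14` (the sentence "(14) with C₁ = L³"; decls `B11Thm1.VarProblemA.Sat14`, `B11.LGData.Sat14`, abstract) —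
here the printed inference itself, for the CONCRETE objects: `step13` = (12) ∧ (11) ⟹ (13) and `sat14_L3` = (13) ⟹
(14) with `C₁ = L³` (kind «model-instance»; the abstract tower `B11Thm1.Tower` is not instantiated — its datum `V0`
would fix one recipe for `V₀`, whereas print and this file use only the displayed PROPERTIES (11) of `V₀`).
Mega-formalization `lit-balaban`, HOME `run/shared/lean/pub/lit-balaban/`, Phase-2 proof seat `p29` gen 3, unit
`lit-balaban-p29` (companion of `B11Eq7Convention` p246204 / `B11Rem278`, same seat).  Owner r08 decides the row cells.

THE PRINTED TEXT (pp. 279–280, verbatim).  *"We start a proof of Theorem 1 for some k assuming that it is true for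
k − 1. We have a configuration V defined on 𝔅_k and satisfying (7). The set 𝔅_k determines the following set
𝔅′_{k−1} = ⋃_{j=0}^{k−1} Λ′_j, Λ′_j = Λ_j for j = 0, 1, …, k − 2, Λ′_{k−1} = Λ_{k−1} ∪ B(Λ_k). We can easily construct
a configuration V₀ on 𝔅′_{k−1} such that it satisfies (7) on 𝔅′_{k−1}, and V₀ = V on ⋃_{j=0}^{k−1} Λ_j, V̄₀ = V on
Λ_k. (11) … We get a minimal configuration U₀ = U_{k−1}(V₀) belonging to the space 𝔘_{k−1}({Ω_j}, B₃ε₁) ∩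
𝔅_{k−1}(𝔅′_{k−1}, V₀). (12)  From the conditions (11), and from the form (2) of the regularity conditions, it follows
that U₀ ∈ 𝔘_k({Ω_j}, B₃L³ε₁) ∩ 𝔅_k(𝔅_k, V), (13) … We assume that we have a configuration U₀ satisfying U₀ ∈
𝔘_k({Ω_j}, C₁B₃ε₁), |Ū₀^j − V| < C₁ε₁ on Λ_j, j = 0, 1, …, k, (14) for some absolute constant C₁. The configuration
U₀ constructed above satisfies (14) with C₁ = L³."*

THE ARGUMENT FORMALISED (levels `k = n + 1`, `k − 1 = n`).  𝔘-PART ("the form (2)", `inAk_succ`): for `j ≤ k − 1` the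
thresholds of (2) with `B₃ε₁` are below those with `L³B₃ε₁`; at the new level `j = k` a plaquette / bond touching
`Ω_k ⊂ Ω_{k−1}` ((1): `DomainSeq.anti`) obeys (2) at level `k − 1`, and `B₃ε₁L^{−2(k−1)} = L²·B₃ε₁L^{−2k} ≤
L³B₃ε₁L^{−2k}`, `B₃ε₁L^{−2(k−1)}(L^{k−1}η)^{−1} = L³·B₃ε₁L^{−2k}(L^kη)^{−1}` (`B8Ineq132.thr7_le_cube`, `thr9_le_cube`).
𝔅-PART ((11), `inB_succ`): on the bonds touching `Λ_j`, `j ≤ k − 1` (⊂ those touching `Λ′_j`): `Ū₀^j = V₀ = V` by (12)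
and (11); on a bond `c` touching `Λ_k`: `Ū₀^k(c) = \overline{Ū₀^{k−1}}(c)` (43) depends only on `Ū₀^{k−1}` on the
bonds of `B(c₋) ∪ B(c₊)` ([4] p. 24, `bavg_congr`), which lie over `Λ′_{k−1} = Ω_{k−1}^{(k−1)}` (`B^k(c_±) ⊂ Ω_{k−1}` by
(1), `B11Eq7Convention.mem_of_fatBlock`), where `Ū₀^{k−1} = V₀` by (12); hence `Ū₀^k(c) = V̄₀(c) = V(c)` by (11).
(14): the first clause is (13) (`C₁B₃ε₁ = L³B₃ε₁`), the second holds with `|Ū₀^j − V| = 0` on `Λ_j` by (13).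

MODEL / DECLARED DEVIATIONS (those of `B11Eq7Convention` (M1)–(M4) inherited).  (M8) `𝔅′_{k−1}`: in the model the
`(k−1)`-level problem of the SAME domain sequence `{Ω_j}` — its level sets `Lam L Ω (k−1) j` ARE `Λ′_j` (`= Λ_j` for
`j ≤ k − 2`, and `Lam L Ω (k−1) (k−1) = Ω_{k−1}^{(k−1)} = Λ_{k−1} ∪ Ω_k^{(k−1)} = Λ_{k−1} ∪ B(Λ_k)` under (1)), so
`𝔅_{k−1}(𝔅′_{k−1}, V₀)` is `InB L (k−1) Ω V₀` and `𝔘_{k−1}({Ω_j}, ·)` is `InAk L (k−1) …` verbatim.  (M9) (11) enters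
through its two displayed PROPERTIES `V₀ = V on ⋃_{j<k} Λ_j` and `V̄₀ = V on Λ_k` (hypotheses `h11a`, `h11b`, bonds
"touching" as in [6] p. 77); the printed example recipe for `V₀` and its property "(7) on 𝔅′_{k−1}" (leaf
`B11Thm1.StepA11`, the cell's open item G-B11-A1) are not used by the inference (12) ⇒ (13) and are not analysed here.
(M10) `U₀` is any configuration of the space (12) (print infers (13) from membership, not minimality — as
`B11Thm1.StepA13`).  Net new unproved facts: 0 (theorems only).
-/

noncomputable section

open scoped BigOperators
open NormedSpace Finset

namespace Literature.MathematicalPhysics.QuantumFieldTheory.Balaban1983to89.B11Eq13Concrete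

open B7Prop1Explicit B7Prop2Explicit B7Prop1Local B8Ineq132 B11Eq7Convention
open B8ConstraintBonds (DomainSeq)

-- `Site` alone could resolve to the torus sites of `Setup.lean`; re-export the `ℤ^d` sites of `B7Prop1Explicit`.
export B7Prop1Explicit (Site)

variable {d : ℕ}

/-! ## §1 `𝔅′_{k−1}` inside the model, and the block of a neighbour -/

section Geometry

/-- **`Λ_j ⊂ Λ′_j`** (p. 279: `Λ′_j = Λ_j`, `j ≤ k − 2`; `Λ′_{k−1} = Λ_{k−1} ∪ B(Λ_k)`): the level sets of the
`(k−1)`-level problem contain those of the `k`-level problem (M8; `k − 1 = n`). [cite: Balaban1985Variational, p.279 (definition of 𝔅′_{k−1})] -/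
theorem lam_succ_subset {L : ℕ} {Ω : ℕ → Set (Site d)} {n j : ℕ} :
    Lam L Ω (n + 1) j ⊆ Lam L Ω n j := fun _ hy =>
  ⟨hy.1, fun hjn => hy.2 (hjn.trans (Nat.lt_succ_self n))⟩

/-- `Λ′_{k−1} = Ω_{k−1}^{(k−1)}` in the model: every level-`(k−1)` point whose fine site lies in `Ω_{k−1}` belongs to the
top level set of the `(k−1)`-level problem (M8). [cite: Balaban1985Variational, p.279 (definition of 𝔅′_{k−1})] -/
theorem mem_lam_top_iff {L : ℕ} {Ω : ℕ → Set (Site d)} {n : ℕ} {w : Site d} :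
    w ∈ Lam L Ω n n ↔ loK L n w ∈ Ω n :=
  ⟨fun h => h.1, fun h => ⟨h, fun hn => (lt_irrefl n hn).elim⟩⟩

/-- The `(n+1)`-block of a point `c` at sup-distance `≤ 1` from a point `y₀ ∈ Ω_{n+1}^{(n+1)}` lies in `Ω_n`
(`B11Eq7Convention.mem_of_fatBlock`, the collar of (1)); here for the two end-points of a bond touching `Λ_k`
("Λ′_{k−1} = Λ_{k−1} ∪ B(Λ_k)"). [cite: Balaban1985Variational, (1) p.277, p.279 (definition of 𝔅′_{k−1})] -/
theorem mem_of_under_near {L : ℕ} (hL : 1 ≤ L) {Ω : ℕ → Set (Site d)} (hΩ : DomainSeq L Ω) {n : ℕ}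
    {y₀ c : Site d} (hy₀ : loK L (n + 1) y₀ ∈ Ω (n + 1)) (hc : ∀ i, y₀ i - 1 ≤ c i ∧ c i ≤ y₀ i + 1)
    {z : Site d} (hz : Under L (n + 1) c z) : z ∈ Ω n := by
  refine mem_of_fatBlock hL hΩ hy₀ fun i => ?_
  have hP : (0 : ℤ) ≤ (L : ℤ) ^ (n + 1) := by positivity
  have h1 : (L : ℤ) ^ (n + 1) * (y₀ i - 1) ≤ (L : ℤ) ^ (n + 1) * c i := mul_le_mul_of_nonneg_left (hc i).1 hP
  have h2 : (L : ℤ) ^ (n + 1) * (c i + 1) ≤ (L : ℤ) ^ (n + 1) * (y₀ i + 2) :=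
    mul_le_mul_of_nonneg_left (by linarith [(hc i).2]) hP
  exact ⟨h1.trans (hz i).1, (hz i).2.trans h2⟩

end Geometry

/-! ## §2 (12) ∧ (11) ⟹ (13), and (14) with `C₁ = L³` -/

section Step

variable {𝔸 : Type*} [NormedRing 𝔸] [NormOneClass 𝔸] [NormedAlgebra ℂ 𝔸] [CompleteSpace 𝔸]

omit [NormOneClass 𝔸] [CompleteSpace 𝔸] in
/-- **𝔘-part of (13), "from the form (2) of the regularity conditions":** `U₀ ∈ 𝔘_{k−1}({Ω_j}, α)` ⟹
`U₀ ∈ 𝔘_k({Ω_j}, L³α)` (`k = n + 1`; at the new level `k` the plaquettes / bonds touching `Ω_k ⊂ Ω_{k−1}` obey (2) at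
level `k − 1`, whose thresholds are `L²` resp. `L³` times those of level `k`).
[cite: Balaban1985Variational, (12)–(13) p.280; Balaban1985RegularSpaces, (1.7)–(1.9) p.77] -/
theorem inAk_succ {L : ℕ} (hL : 1 ≤ L) {Ω : ℕ → Set (Site d)} (hΩ : DomainSeq L Ω) {η α : ℝ} (hη : 0 < η)
    (hα : 0 ≤ α) {n : ℕ} {U : Site d → Fin d → 𝔸ˣ} (hA : InAk L n η α Ω U) :
    InAk L (n + 1) η ((L : ℝ) ^ 3 * α) Ω U := by
  intro j hj
  rcases Nat.lt_or_ge j (n + 1) with hjn | hjn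
  · have h := hA j (Nat.lt_succ_iff.mp hjn)
    exact ⟨fun x μ ν hμν hp => (h.1 x μ ν hμν hp).trans_le (thr7_le_cube hL hα (Nat.le_succ j)),
      fun x μ hb => (h.2 x μ hb).trans_le (thr9_le_cube hL hα hη (Nat.le_succ j))⟩
  · obtain rfl : j = n + 1 := le_antisymm hj hjn
    have h := condAt_anti (hΩ.anti n) (hA n le_rfl)
    exact ⟨fun x μ ν hμν hp => (h.1 x μ ν hμν hp).trans_le (thr7_le_cube hL hα le_rfl),
      fun x μ hb => (h.2 x μ hb).trans_le (thr9_le_cube hL hα hη le_rfl)⟩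

omit [NormOneClass 𝔸] in
/-- **𝔅-part of (13), "from the conditions (11)":** `U₀ ∈ 𝔅_{k−1}(𝔅′_{k−1}, V₀)` with `V₀ = V on ⋃_{j<k} Λ_j` and
`V̄₀ = V on Λ_k` ⟹ `U₀ ∈ 𝔅_k(𝔅_k, V)` (`k = n + 1`).  On the bonds touching `Λ_j`, `j < k`: `Ū₀^j = V₀ = V`; on a
bond `c` touching `Λ_k`: `Ū₀^k(c) = \overline{Ū₀^{k−1}}(c)` only involves `Ū₀^{k−1} = V₀` on the bonds of
`B(c₋) ∪ B(c₊) ⊂ Λ′_{k−1}` (locality of (43), [4] p. 24), so `Ū₀^k(c) = V̄₀(c) = V(c)`.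
[cite: Balaban1985Variational, (11)–(13) pp.279–280; Balaban1985Averaging, (43) p.24] -/
theorem inB_succ {L : ℕ} (hL : 1 ≤ L) {Ω : ℕ → Set (Site d)} (hΩ : DomainSeq L Ω) {n : ℕ}
    {V₀ V : ℕ → Site d → Fin d → 𝔸ˣ} {U : Site d → Fin d → 𝔸ˣ}
    (h11a : ∀ j, j ≤ n → ∀ (y : Site d) (κ : Fin d), BondTouches (Lam L Ω (n + 1) j) y κ → V₀ j y κ = V j y κ)
    (h11b : ∀ (y : Site d) (κ : Fin d), BondTouches (Lam L Ω (n + 1) (n + 1)) y κ →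
      avgIter L (V₀ n) 1 y κ = V (n + 1) y κ)
    (hB : InB L n Ω V₀ U) : InB L (n + 1) Ω V U := by
  intro j hj y κ ht
  rcases Nat.lt_or_ge j (n + 1) with hjn | hjn
  · have hjn' : j ≤ n := Nat.lt_succ_iff.mp hjn
    have ht' : BondTouches (Lam L Ω n j) y κ := by
      rcases ht with h | h
      exacts [Or.inl (lam_succ_subset h), Or.inr (lam_succ_subset h)]
    rw [hB j hjn' y κ ht', h11a j hjn' y κ ht]
  · obtain rfl : j = n + 1 := le_antisymm hj hjn
    rw [← h11b y κ ht]
    show rescale L (bavg L (avgIter L U n)) y κ = rescale L (bavg L (V₀ n)) y κ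
    simp only [rescale_apply]
    -- one end-point `y₀` of the bond lies in `Λ_k`; both end-points are within sup-distance `1` of it
    obtain ⟨y₀, hy₀, hyn, hyκn⟩ : ∃ y₀ : Site d, loK L (n + 1) y₀ ∈ Ω (n + 1) ∧
        (∀ i, y₀ i - 1 ≤ y i ∧ y i ≤ y₀ i + 1) ∧ (∀ i, y₀ i - 1 ≤ (y + e κ) i ∧ (y + e κ) i ≤ y₀ i + 1) := by
      rcases ht with h | h
      · refine ⟨y, h.1, fun i => ⟨by linarith, by linarith⟩, fun i => ?_⟩
        rw [add_e_apply]; split_ifs <;> constructor <;> linarith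
      · refine ⟨y + e κ, h.1, fun i => ?_, fun i => ⟨by linarith, by linarith⟩⟩
        rw [add_e_apply]; split_ifs <;> constructor <;> linarith
    refine bavg_congr L hL _ κ fun w κ' hw _ => hB n le_rfl w κ' (Or.inl (mem_lam_top_iff.2 ?_))
    rcases under_of_bondBox hL n hw with hu | hu
    · exact mem_of_under_near hL hΩ hy₀ hyn hu
    · exact mem_of_under_near hL hΩ hy₀ hyκn hu

omit [NormOneClass 𝔸] in
/-- **(12) ∧ (11) ⟹ (13)** (p. 280), for every configuration `U₀` of the space (12) (`k = n + 1`, `𝔅′_{k−1}` = the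
level sets `Lam L Ω (k−1) ·` of the same domain sequence, (11) = `h11a`, `h11b`):
`U₀ ∈ 𝔘_{k−1}({Ω_j}, B₃ε₁) ∩ 𝔅_{k−1}(𝔅′_{k−1}, V₀)` ⟹ `U₀ ∈ 𝔘_k({Ω_j}, L³B₃ε₁) ∩ 𝔅_k(𝔅_k, V)`.
[cite: Balaban1985Variational, (12)–(13) p.280] -/
theorem step13 {L : ℕ} (hL : 1 ≤ L) {Ω : ℕ → Set (Site d)} (hΩ : DomainSeq L Ω) {η B₃ ε₁ : ℝ} (hη : 0 < η)
    (hB₃ε : 0 ≤ B₃ * ε₁) {n : ℕ} {V₀ V : ℕ → Site d → Fin d → 𝔸ˣ} {U₀ : Site d → Fin d → 𝔸ˣ}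
    (h11a : ∀ j, j ≤ n → ∀ (y : Site d) (κ : Fin d), BondTouches (Lam L Ω (n + 1) j) y κ → V₀ j y κ = V j y κ)
    (h11b : ∀ (y : Site d) (κ : Fin d), BondTouches (Lam L Ω (n + 1) (n + 1)) y κ →
      avgIter L (V₀ n) 1 y κ = V (n + 1) y κ)
    (h12 : InAk L n η (B₃ * ε₁) Ω U₀ ∧ InB L n Ω V₀ U₀) :
    InAk L (n + 1) η ((L : ℝ) ^ 3 * (B₃ * ε₁)) Ω U₀ ∧ InB L (n + 1) Ω V U₀ :=
  ⟨inAk_succ hL hΩ hη hB₃ε h12.1, inB_succ hL hΩ h11a h11b h12.2⟩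

omit [NormOneClass 𝔸] in
/-- **"The configuration U₀ constructed above satisfies (14) with C₁ = L³"** (p. 280): from (13), `U₀ ∈ 𝔘_k({Ω_j},
C₁B₃ε₁)` with `C₁ = L³`, and `|Ū₀^j − V| < C₁ε₁` on (the bonds touching) `Λ_j`, `j = 0, …, k` — indeed `Ū₀^j = V`
there by the 𝔅-part of (13), so the difference is `0 < L³ε₁`. [cite: Balaban1985Variational, (14) p.280] -/
theorem sat14_L3 {L : ℕ} (hL : 1 ≤ L) {Ω : ℕ → Set (Site d)} {k : ℕ} {η B₃ ε₁ : ℝ} (hε : 0 < ε₁)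
    {V : ℕ → Site d → Fin d → 𝔸ˣ} {U₀ : Site d → Fin d → 𝔸ˣ}
    (h13 : InAk L k η ((L : ℝ) ^ 3 * (B₃ * ε₁)) Ω U₀ ∧ InB L k Ω V U₀) :
    InAk L k η ((L : ℝ) ^ 3 * B₃ * ε₁) Ω U₀ ∧
      ∀ j, j ≤ k → ∀ (y : Site d) (κ : Fin d), BondTouches (Lam L Ω k j) y κ →
        ‖((avgIter L U₀ j y κ : 𝔸ˣ) : 𝔸) - (V j y κ : 𝔸)‖ < (L : ℝ) ^ 3 * ε₁ := by
  have hL0 : (0 : ℝ) < L := by exact_mod_cast hL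
  refine ⟨by rw [mul_assoc]; exact h13.1, fun j hj y κ ht => ?_⟩
  rw [h13.2 j hj y κ ht, sub_self, norm_zero]
  positivity

omit [NormOneClass 𝔸] in
/-- **Sect. A in one stroke** (p. 280): the inductive background `U₀` — any configuration of the space (12) for data
`V₀` with (11) — satisfies (13) and hence the standing assumption (14) with `C₁ = L³` (`k = n + 1`).
[cite: Balaban1985Variational, (11)–(14) pp.279–280] -/
theorem sat14_of_12 {L : ℕ} (hL : 1 ≤ L) {Ω : ℕ → Set (Site d)} (hΩ : DomainSeq L Ω) {η B₃ ε₁ : ℝ} (hη : 0 < η)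
    (hB₃ : 0 ≤ B₃) (hε : 0 < ε₁) {n : ℕ} {V₀ V : ℕ → Site d → Fin d → 𝔸ˣ} {U₀ : Site d → Fin d → 𝔸ˣ}
    (h11a : ∀ j, j ≤ n → ∀ (y : Site d) (κ : Fin d), BondTouches (Lam L Ω (n + 1) j) y κ → V₀ j y κ = V j y κ)
    (h11b : ∀ (y : Site d) (κ : Fin d), BondTouches (Lam L Ω (n + 1) (n + 1)) y κ →
      avgIter L (V₀ n) 1 y κ = V (n + 1) y κ)
    (h12 : InAk L n η (B₃ * ε₁) Ω U₀ ∧ InB L n Ω V₀ U₀) :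
    InAk L (n + 1) η ((L : ℝ) ^ 3 * B₃ * ε₁) Ω U₀ ∧
      ∀ j, j ≤ n + 1 → ∀ (y : Site d) (κ : Fin d), BondTouches (Lam L Ω (n + 1) j) y κ →
        ‖((avgIter L U₀ j y κ : 𝔸ˣ) : 𝔸) - (V j y κ : 𝔸)‖ < (L : ℝ) ^ 3 * ε₁ :=
  sat14_L3 hL hε (step13 hL hΩ hη (mul_nonneg hB₃ hε.le) h11a h11b h12)

end Step

/-! ## §3 The same on the concrete carrier `B11Eq7Convention.concreteVarProblem` -/

section Concrete

variable {𝔸 : Type} [NormedRing 𝔸] [NormOneClass 𝔸] [NormedAlgebra ℂ 𝔸] [CompleteSpace 𝔸]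

omit [NormOneClass 𝔸] in
/-- **(12) ⟹ (13) landing in the concrete carrier** `P = concreteVarProblem d 𝔸 L G X i`, `i = (k; {Ω_j})`,
`k = n + 1`: for `V₀` with (11) and a configuration `U₀` of the space (12) — the `(k−1)`-level space ON THE SAME LATTICE
`T_η`, `η = L^{−k}` (print keeps one `η` for both levels; so (12) is written with `InAk … (k−1) … η …` directly rather
than through the carrier of the datum `(k − 1; {Ω_j})`, whose own spacing field would be `L^{−(k−1)}`) — one gets
`P.InU (L³B₃ε₁) U₀ ∧ P.InB V U₀`, i.e. (13). [cite: Balaban1985Variational, (12)–(13) p.280] -/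
theorem step13_concrete (L : ℕ) (hL : 1 ≤ L) (G : Subgroup 𝔸ˣ) (X : OtherData d 𝔸 G) (i : GeomDatum d L)
    {n : ℕ} (hk : i.k = n + 1) {B₃ ε₁ : ℝ} (hB₃ε : 0 ≤ B₃ * ε₁) {V₀ V : ℕ → Site d → Fin d → 𝔸ˣ}
    (h11a : ∀ j, j ≤ n → ∀ (y : Site d) (κ : Fin d), BondTouches (Lam L i.Ω (n + 1) j) y κ → V₀ j y κ = V j y κ)
    (h11b : ∀ (y : Site d) (κ : Fin d), BondTouches (Lam L i.Ω (n + 1) (n + 1)) y κ →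
      avgIter L (V₀ n) 1 y κ = V (n + 1) y κ)
    (U₀ : (concreteVarProblem d 𝔸 L G X i).Cfg)
    (h12 : InAk L n (((L : ℝ) ^ i.k)⁻¹) (B₃ * ε₁) i.Ω U₀.1 ∧ InB L n i.Ω V₀ U₀.1) :
    (concreteVarProblem d 𝔸 L G X i).InU ((L : ℝ) ^ 3 * (B₃ * ε₁)) U₀ ∧
      (concreteVarProblem d 𝔸 L G X i).InB V U₀ := by
  have hη : (0 : ℝ) < ((L : ℝ) ^ i.k)⁻¹ := by
    have hL0 : (0 : ℝ) < L := by exact_mod_cast hL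
    positivity
  have h := step13 hL i.adm hη hB₃ε h11a h11b h12
  rw [← hk] at h
  exact h

end Concrete

end Literature.MathematicalPhysics.QuantumFieldTheory.Balaban1983to89.B11Eq13Concrete
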